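import Literature.MathematicalPhysics.QuantumManyBody.BoseGasThermodynamicLimitRuelle
import Literature.MathematicalPhysics.QuantumManyBody.PeriodicBoseGasJastrow
import Mathlib.Topology.Connected.PathConnected
import Mathlib.Analysis.Convex.PathConnected
import Mathlib.Topology.MetricSpace.Sequences
import Mathlib.Analysis.SpecificLimits.Basic
import HarnessLib

/-!
# Crux `GridInfDivCoherence` (stmt-AtomisticToContinuum-9114), line `registered`: sub-goal (A) of the dilute
# hard-sphere connectivity statement — every configuration of the free region is joined, inside it, to a
# maximiser of the minimal image pair distance over its path component

The free region of `N` hard spheres with exclusion distance `b` on the torus `ℝ³/Lℤ³`, written on `(ℝ³)^N` with all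
lattice images, is `F = {X | ∀ i ≠ j, ∀ n ∈ ℤ³, b < ‖X i - X j - L n‖}`. For `X ∈ F` we produce `Z ∈ F` joined to `X`
inside `F` such that every common lower bound `d` of the image pair distances of ANY `Y` joined to `X` is a common
lower bound of the image pair distances of `Z`, i.e. `Z` maximises the minimal image pair distance
`md Y = min_{i ≠ j, n} ‖Y i - Y j - L n‖` over the path component of `X` in `F`
(`freeRegion_exists_joined_maximiser`, the registered signature).

Proof (namespace `FreeRegionMaximiser`, elementary compactness; no auxiliary definitions): for `L > 0` only
finitely many lattice images of a point lie in a bounded region (each coordinate of the index is an integer in a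
bounded interval, as in the tree's `PositiveMinimiser.finite_latticeVec_near`, not imported to keep the import
closure small), so the distances to the images tend to infinity along the cofinite filter and the minimal image pair
distance of `N ≥ 2` particles is attained (`exists_min_imageDist`), hence `> b` on `F`; every common lower bound is
`≤ L` (the nearest image `reduce` of `PeriodicBoseGasJastrow.lean`). Let `T` be the set of common lower bounds `d` of
the image pair distances of some `Y` in the path component `C` of `X`, and `S = sup T > b`. Take `Y_k ∈ C` with a
common lower bound `d_k > S - 1/(k+1)`, reduce every particle modulo `Lℤ³` into `[0,L)³` (a per-particle lattice
translation, which preserves `F` and re-indexes the image differences, `add_latticeShift_pair`), extract a convergent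
subsequence `Y'_{φ k} → Z₀` (the configuration space is proper), and pass to the limit in each image distance: all
image distances of `Z₀` are `≥ S > b`. Hence the ball of radius `(S - b)/2` about `Z₀` lies in `F`, is convex, and
contains some `Y'_{φ K}`; translating the segment back by the lattice translation of `Y_{φ K}` joins `Y_{φ K}`, hence
`X`, to `Z = Z₀ + (translation)` inside `F`, and every image distance of `Z` is `≥ S ≥ d` for every `d ∈ T`. No
continuity of `md` and no openness of `F` beyond this uniform room is needed. For `N ≤ 1` there are no pairs and
`Z = X`.

References: folklore (configuration spaces of hard spheres, e.g. Baryshnikov–Bubenik–Kahle, IMRN 2014, §2); Mathlib's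
`tendsto_subseq_of_bounded`, `JoinedIn.of_segment_subset`, `Filter.Tendsto.exists_forall_le`; the tree's
`abs_apply_le_norm`, `reduce`, `abs_reduce_apply_le` (`PeriodicBoseGasJastrow.lean`) and `latticeVec_add/_sub/_apply`
(`PeriodicBoseGasLemma32.lean`).
-/

noncomputable section

namespace Summit.AtomisticToContinuum.BoseEinsteinCondensation.Theorems

open Filter Literature.MathematicalPhysics.QuantumManyBody Literature.MathematicalPhysics.QuantumManyBody.BoseGas
open scoped Topology

namespace FreeRegionMaximiser

variable {N : ℕ} {L : ℝ}

/-! ### The Euclidean norm on `ℝ³` -/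

/-- If all three coordinates are at most `a` in absolute value then the Euclidean norm is at most `2a`
(indeed `≤ √3 a`). [folklore] -/
theorem norm_le_two_mul_of_abs_le {x : Space} {a : ℝ} (ha : 0 ≤ a) (h : ∀ k, |x k| ≤ a) : ‖x‖ ≤ 2 * a := by
  have hsq : ‖x‖ ^ 2 ≤ (2 * a) ^ 2 := by
    rw [EuclideanSpace.real_norm_sq_eq, Fin.sum_univ_three]
    have h0 := sq_le_sq' (abs_le.1 (h 0)).1 (abs_le.1 (h 0)).2
    have h1 := sq_le_sq' (abs_le.1 (h 1)).1 (abs_le.1 (h 1)).2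
    have h2 := sq_le_sq' (abs_le.1 (h 2)).1 (abs_le.1 (h 2)).2
    nlinarith
  exact (sq_le_sq₀ (norm_nonneg _) (by positivity)).1 hsq

/-! ### Local finiteness of the lattice images and the attained minimal image pair distance -/

/-- The distances `‖w - L n‖` to the lattice images of a point tend to infinity along the cofinite filter of `ℤ³`
(`L > 0`): only finitely many images lie in a ball, each coordinate of such an `n` being an integer in a bounded
interval. [folklore] -/
theorem tendsto_norm_sub_latticeVec_cofinite (hL : 0 < L) (w : Space) :
    Tendsto (fun n : Fin 3 → ℤ => ‖w - latticeVec L n‖) cofinite atTop := by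
  refine tendsto_atTop.2 fun R => Filter.eventually_cofinite.2 ?_
  refine (Set.Finite.pi (t := fun k : Fin 3 => Set.Icc ⌊(w k - R) / L⌋ ⌈(w k + R) / L⌉)
    fun k => Set.finite_Icc _ _).subset ?_
  intro n hn
  replace hn : ‖w - latticeVec L n‖ ≤ R := le_of_lt (not_le.1 hn)
  simp only [Set.mem_pi, Set.mem_univ, Set.mem_Icc, forall_const]
  intro k
  have hk : |w k - L * n k| ≤ R := by
    have h := abs_apply_le_norm (w - latticeVec L n) k
    simp only [PiLp.sub_apply, latticeVec_apply] at h
    exact h.trans hn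
  rcases abs_le.1 hk with ⟨h1, h2⟩
  constructor
  · have : (w k - R) / L ≤ (n k : ℝ) := by
      rw [div_le_iff₀ hL]; linarith [mul_comm L (n k : ℝ)]
    exact Int.cast_le.1 ((Int.floor_le _).trans this)
  · have : (n k : ℝ) ≤ (w k + R) / L := by
      rw [le_div_iff₀ hL]; linarith [mul_comm L (n k : ℝ)]
    exact Int.cast_le.1 (this.trans (Int.le_ceil _))

/-- **The minimal image pair distance of `N ≥ 2` particles is attained** (`L > 0`): some pair `i ≠ j` and image `n₀`
realise `min_{i' ≠ j', n} ‖Y i' - Y j' - L n‖` — first in the image for each of the finitely many pairs (the distances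
to the images tend to infinity), then over the pairs. [folklore] -/
theorem exists_min_imageDist (hL : 0 < L) {i₀ j₀ : Fin N} (h₀ : i₀ ≠ j₀) (Y : Config N) :
    ∃ i j : Fin N, i ≠ j ∧ ∃ n₀ : Fin 3 → ℤ, ∀ i' j' : Fin N, i' ≠ j' → ∀ n : Fin 3 → ℤ,
      ‖Y i - Y j - latticeVec L n₀‖ ≤ ‖Y i' - Y j' - latticeVec L n‖ := by
  have hmin : ∀ q : {q : Fin N × Fin N // q.1 ≠ q.2}, ∃ n₀ : Fin 3 → ℤ, ∀ n : Fin 3 → ℤ,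
      ‖Y q.1.1 - Y q.1.2 - latticeVec L n₀‖ ≤ ‖Y q.1.1 - Y q.1.2 - latticeVec L n‖ := fun q =>
    (tendsto_norm_sub_latticeVec_cofinite hL (Y q.1.1 - Y q.1.2)).exists_forall_le
  choose n₀ hn₀ using hmin
  haveI : Nonempty {q : Fin N × Fin N // q.1 ≠ q.2} := ⟨⟨(i₀, j₀), h₀⟩⟩
  obtain ⟨q₀, hq₀⟩ :=
    Finite.exists_min fun q : {q : Fin N × Fin N // q.1 ≠ q.2} => ‖Y q.1.1 - Y q.1.2 - latticeVec L (n₀ q)‖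
  exact ⟨q₀.1.1, q₀.1.2, q₀.2, n₀ q₀, fun i' j' hij n => (hq₀ ⟨(i', j'), hij⟩).trans (hn₀ ⟨(i', j'), hij⟩ n)⟩

/-- In the free region (`N ≥ 2`, `L > 0`) the image pair distances have a common lower bound `d > b`, namely their
attained minimum. [folklore] -/
theorem exists_gt_forall_le (hL : 0 < L) {i₀ j₀ : Fin N} (h₀ : i₀ ≠ j₀) {b : ℝ} {Y : Config N}
    (hY : ∀ i j : Fin N, i ≠ j → ∀ n : Fin 3 → ℤ, b < ‖Y i - Y j - latticeVec L n‖) :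
    ∃ d : ℝ, b < d ∧ ∀ i j : Fin N, i ≠ j → ∀ n : Fin 3 → ℤ, d ≤ ‖Y i - Y j - latticeVec L n‖ := by
  obtain ⟨i, j, hij, n₀, h⟩ := exists_min_imageDist hL h₀ Y
  exact ⟨_, hY i j hij n₀, h⟩

/-- A common lower bound of the image pair distances of `N ≥ 2` particles is `≤ L`: the nearest image
`reduce L (Y i - Y j)` (coordinatewise rounding) has all coordinates `≤ L/2` in absolute value. [folklore] -/
theorem le_length_of_forall_le (hL : 0 < L) {i₀ j₀ : Fin N} (h₀ : i₀ ≠ j₀) {d : ℝ} {Y : Config N}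
    (h : ∀ i j : Fin N, i ≠ j → ∀ n : Fin 3 → ℤ, d ≤ ‖Y i - Y j - latticeVec L n‖) : d ≤ L := by
  refine (h i₀ j₀ h₀ (nearestLat L (Y i₀ - Y j₀))).trans ?_
  have : ‖Y i₀ - Y j₀ - latticeVec L (nearestLat L (Y i₀ - Y j₀))‖ ≤ 2 * (L / 2) :=
    norm_le_two_mul_of_abs_le (by positivity) fun k => abs_reduce_apply_le hL (Y i₀ - Y j₀) k
  linarith

/-! ### Per-particle lattice translations -/

/-- A per-particle lattice translation `W ↦ W + (L m_i)_i` re-indexes the image pair differences. [folklore] -/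
theorem add_latticeShift_pair (L : ℝ) (m : Fin N → Fin 3 → ℤ) (W : Config N) (i j : Fin N) (n : Fin 3 → ℤ) :
    (W + fun i => latticeVec L (m i)) i - (W + fun i => latticeVec L (m i)) j - latticeVec L n =
      W i - W j - latticeVec L (n - m i + m j) := by
  simp only [Pi.add_apply, latticeVec_add, latticeVec_sub]
  abel

/-- The free region is preserved by per-particle lattice translations. [folklore] -/
theorem forall_lt_add_latticeShift {b : ℝ} {W : Config N} (m : Fin N → Fin 3 → ℤ)
    (h : ∀ i j : Fin N, i ≠ j → ∀ n : Fin 3 → ℤ, b < ‖W i - W j - latticeVec L n‖) :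
    ∀ i j : Fin N, i ≠ j → ∀ n : Fin 3 → ℤ,
      b < ‖(W + fun i => latticeVec L (m i)) i - (W + fun i => latticeVec L (m i)) j - latticeVec L n‖ := by
  intro i j hij n
  rw [add_latticeShift_pair]
  exact h i j hij _

/-- Joinability inside a translation-invariant set is preserved by the translation. [folklore] -/
theorem joinedIn_add_right {F : Set (Config N)} {c : Config N} (hF : ∀ W ∈ F, W + c ∈ F) {x y : Config N}
    (h : JoinedIn F x y) : JoinedIn F (x + c) (y + c) :=
  (h.map (continuous_add_const c)).mono (Set.image_subset_iff.2 fun W hW => hF W hW)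

/-! ### The maximiser -/

/-- **Maximiser of the minimal image pair distance over a path component** (`N ≥ 2`, `L > 0`): every `X` in the free
region is joined inside it to some `Z` such that every common lower bound of the image pair distances of any `Y`
joined to `X` is a common lower bound of the image pair distances of `Z`. Maximising sequence for the supremum `S` of
such bounds, reduction modulo `Lℤ³` per particle, Bolzano–Weierstrass, passage to the limit in each image distance, a
convex ball of room `(S - b)/2` inside the free region, and translation back. [folklore] -/
theorem exists_joined_maximiser (hL : 0 < L) {b : ℝ} {i₀ j₀ : Fin N} (h₀ : i₀ ≠ j₀) {X : Config N}
    (hX : X ∈ {X : Config N | ∀ i j : Fin N, i ≠ j → ∀ n : Fin 3 → ℤ, b < ‖X i - X j - latticeVec L n‖}) :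
    ∃ Z ∈ {X : Config N | ∀ i j : Fin N, i ≠ j → ∀ n : Fin 3 → ℤ, b < ‖X i - X j - latticeVec L n‖},
      JoinedIn {X : Config N | ∀ i j : Fin N, i ≠ j → ∀ n : Fin 3 → ℤ, b < ‖X i - X j - latticeVec L n‖} X Z ∧
      ∀ Y : Config N,
        JoinedIn {X : Config N | ∀ i j : Fin N, i ≠ j → ∀ n : Fin 3 → ℤ, b < ‖X i - X j - latticeVec L n‖} X Y →
        ∀ d : ℝ, (∀ i j : Fin N, i ≠ j → ∀ n : Fin 3 → ℤ, d ≤ ‖Y i - Y j - latticeVec L n‖) →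
          ∀ i j : Fin N, i ≠ j → ∀ n : Fin 3 → ℤ, d ≤ ‖Z i - Z j - latticeVec L n‖ := by
  set F : Set (Config N) := {X : Config N | ∀ i j : Fin N, i ≠ j → ∀ n : Fin 3 → ℤ, b < ‖X i - X j - latticeVec L n‖}
    with hFdef
  -- the common lower bounds realised on the path component of `X`, and their supremum `S > b`
  set T : Set ℝ := {d | ∃ Y, JoinedIn F X Y ∧ ∀ i j : Fin N, i ≠ j → ∀ n : Fin 3 → ℤ, d ≤ ‖Y i - Y j - latticeVec L n‖}
    with hTdef
  obtain ⟨d₀, hbd₀, hd₀⟩ := exists_gt_forall_le hL h₀ hX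
  have hd₀T : d₀ ∈ T := ⟨X, JoinedIn.refl hX, hd₀⟩
  have hTne : T.Nonempty := ⟨d₀, hd₀T⟩
  have hTbdd : BddAbove T := ⟨L, by rintro d ⟨Y, -, hd⟩; exact le_length_of_forall_le hL h₀ hd⟩
  set S := sSup T with hSdef
  have hbS : b < S := hbd₀.trans_le (le_csSup hTbdd hd₀T)
  -- a maximising sequence
  have hseq : ∀ k : ℕ, ∃ Y, JoinedIn F X Y ∧ ∃ d : ℝ, S - 1 / ((k : ℝ) + 1) < d ∧
      ∀ i j : Fin N, i ≠ j → ∀ n : Fin 3 → ℤ, d ≤ ‖Y i - Y j - latticeVec L n‖ := by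
    intro k
    have hk : S - 1 / ((k : ℝ) + 1) < S := by
      have : (0 : ℝ) < 1 / ((k : ℝ) + 1) := by positivity
      linarith
    obtain ⟨d, ⟨Y, hY, hd⟩, hlt⟩ := exists_lt_of_lt_csSup hTne hk
    exact ⟨Y, hY, d, hlt, hd⟩
  choose Y hYX d hdS hd using hseq
  -- reduction of every particle into the cell `[0, L)³`
  obtain ⟨m, hm⟩ : ∃ m : ℕ → Fin N → Fin 3 → ℤ, ∀ k i κ, m k i κ = ⌊Y k i κ / L⌋ := ⟨_, fun _ _ _ => rfl⟩
  obtain ⟨Y', hY'⟩ : ∃ Y' : ℕ → Config N, ∀ k, Y' k = Y k - fun i => latticeVec L (m k i) := ⟨_, fun _ => rfl⟩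
  have hY'bdd : ∀ k, Y' k ∈ Metric.closedBall (0 : Config N) (2 * L) := by
    intro k
    rw [Metric.mem_closedBall, dist_zero_right, pi_norm_le_iff_of_nonneg (by positivity)]
    intro i
    refine norm_le_two_mul_of_abs_le hL.le fun κ => ?_
    have hκ : Y' k i κ = L * Int.fract (Y k i κ / L) := by
      rw [Int.fract, mul_sub, mul_div_cancel₀ _ hL.ne', hY', Pi.sub_apply, PiLp.sub_apply, latticeVec_apply, hm]
    rw [hκ, abs_of_nonneg (mul_nonneg hL.le (Int.fract_nonneg _))]
    calc L * Int.fract (Y k i κ / L) ≤ L * 1 := mul_le_mul_of_nonneg_left (Int.fract_lt_one _).le hL.le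
      _ = L := mul_one L
  -- Bolzano–Weierstrass in the proper space `(ℝ³)^N`
  obtain ⟨Z₀, -, φ, hφ, hlim⟩ := tendsto_subseq_of_bounded Metric.isBounded_closedBall hY'bdd
  -- every image pair distance of the limit is `≥ S`
  have hZ₀ : ∀ i j : Fin N, i ≠ j → ∀ n : Fin 3 → ℤ, S ≤ ‖Z₀ i - Z₀ j - latticeVec L n‖ := by
    intro i j hij n
    have hcont : Continuous fun W : Config N => ‖W i - W j - latticeVec L n‖ := by fun_prop
    have h1 : Tendsto (fun k => ‖Y' (φ k) i - Y' (φ k) j - latticeVec L n‖) atTop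
        (𝓝 ‖Z₀ i - Z₀ j - latticeVec L n‖) := (hcont.tendsto Z₀).comp hlim
    have h2 : Tendsto (fun k : ℕ => S - 1 / ((k : ℝ) + 1)) atTop (𝓝 (S - 0)) :=
      tendsto_const_nhds.sub tendsto_one_div_add_atTop_nhds_zero_nat
    rw [sub_zero] at h2
    refine le_of_tendsto_of_tendsto' h2 h1 fun k => ?_
    have hk : (k : ℝ) ≤ φ k := by exact_mod_cast hφ.id_le k
    have hstep : S - 1 / ((k : ℝ) + 1) ≤ S - 1 / ((φ k : ℝ) + 1) := by
      gcongr
    refine hstep.trans ((hdS (φ k)).le.trans ?_)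
    have hre : Y' (φ k) i - Y' (φ k) j - latticeVec L n =
        Y (φ k) i - Y (φ k) j - latticeVec L (n + m (φ k) i - m (φ k) j) := by
      rw [hY']
      simp only [Pi.sub_apply, latticeVec_add, latticeVec_sub]
      abel
    rw [hre]
    exact hd (φ k) i j hij _
  -- the ball of room `(S - b)/2` about the limit lies in the free region
  set δ : ℝ := (S - b) / 2 with hδ
  have hδpos : 0 < δ := by rw [hδ]; linarith
  have hball : Metric.ball Z₀ δ ⊆ F := by
    intro W hW i j hij n
    rw [Metric.mem_ball, dist_eq_norm] at hW
    have hi : ‖W i - Z₀ i‖ ≤ ‖W - Z₀‖ := norm_le_pi_norm (W - Z₀) i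
    have hj : ‖W j - Z₀ j‖ ≤ ‖W - Z₀‖ := norm_le_pi_norm (W - Z₀) j
    have hZ : S ≤ ‖Z₀ i - Z₀ j - latticeVec L n‖ := hZ₀ i j hij n
    have key : Z₀ i - Z₀ j - latticeVec L n = (W i - W j - latticeVec L n) - ((W i - Z₀ i) - (W j - Z₀ j)) := by
      abel
    have h1 := norm_sub_le (W i - W j - latticeVec L n) ((W i - Z₀ i) - (W j - Z₀ j))
    have h2 := norm_sub_le (W i - Z₀ i) (W j - Z₀ j)
    rw [← key] at h1
    linarith
  have hZ₀F : Z₀ ∈ F := hball (Metric.mem_ball_self hδpos)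
  -- a term of the subsequence inside the ball, joined to the limit along the segment
  obtain ⟨K, hK⟩ := Metric.tendsto_atTop.1 hlim δ hδpos
  have hKball : Y' (φ K) ∈ Metric.ball Z₀ δ := hK K le_rfl
  have hjoin₀ : JoinedIn F (Y' (φ K)) Z₀ :=
    (JoinedIn.of_segment_subset
      ((convex_ball Z₀ δ).segment_subset hKball (Metric.mem_ball_self hδpos))).mono hball
  -- translate back by the lattice translation of `Y (φ K)`
  have hF : ∀ W ∈ F, (W + fun i => latticeVec L (m (φ K) i)) ∈ F := fun W hW =>
    forall_lt_add_latticeShift (m (φ K)) hW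
  have hjoin₁ : JoinedIn F (Y' (φ K) + fun i => latticeVec L (m (φ K) i)) (Z₀ + fun i => latticeVec L (m (φ K) i)) :=
    joinedIn_add_right hF hjoin₀
  have hYK : (Y' (φ K) + fun i => latticeVec L (m (φ K) i)) = Y (φ K) := by rw [hY', sub_add_cancel]
  rw [hYK] at hjoin₁
  refine ⟨Z₀ + fun i => latticeVec L (m (φ K) i), hF Z₀ hZ₀F, (hYX (φ K)).trans hjoin₁,
    fun W hW e he i j hij n => ?_⟩
  -- every realised common lower bound is `≤ S ≤` every image pair distance of `Z`
  have heS : e ≤ S := le_csSup hTbdd ⟨W, hW, he⟩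
  rw [add_latticeShift_pair]
  exact heS.trans (hZ₀ i j hij _)

end FreeRegionMaximiser

/-- **Sub-goal (A) of the dilute hard-sphere connectivity statement G** (crux `GridInfDivCoherence`, line
`registered`): every configuration `X` of the hard-sphere free region
`F = {X | ∀ i ≠ j, ∀ n ∈ ℤ³, b < ‖X i - X j - L n‖}` (`L > 0`) is joined inside `F` to a configuration `Z ∈ F` that
maximises the minimal image pair distance over the path component of `X`: every common lower bound `d` of the image
pair distances of any `Y` joined to `X` in `F` is a common lower bound of the image pair distances of `Z`. For `N ≤ 1`
there are no pairs and `Z = X`. [folklore] -/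
theorem freeRegion_exists_joined_maximiser :
    ∀ (N : ℕ) (L b : ℝ), 0 < L →
      ∀ X ∈ {X : Config N | ∀ i j : Fin N, i ≠ j → ∀ n : Fin 3 → ℤ, b < ‖X i - X j - latticeVec L n‖},
        ∃ Z ∈ {X : Config N | ∀ i j : Fin N, i ≠ j → ∀ n : Fin 3 → ℤ, b < ‖X i - X j - latticeVec L n‖},
          JoinedIn {X : Config N | ∀ i j : Fin N, i ≠ j → ∀ n : Fin 3 → ℤ, b < ‖X i - X j - latticeVec L n‖} X Z ∧
          ∀ Y : Config N,
            JoinedIn {X : Config N | ∀ i j : Fin N, i ≠ j → ∀ n : Fin 3 → ℤ, b < ‖X i - X j - latticeVec L n‖} X Y →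
            ∀ d : ℝ, (∀ i j : Fin N, i ≠ j → ∀ n : Fin 3 → ℤ, d ≤ ‖Y i - Y j - latticeVec L n‖) →
              ∀ i j : Fin N, i ≠ j → ∀ n : Fin 3 → ℤ, d ≤ ‖Z i - Z j - latticeVec L n‖ := by
  intro N L b hL X hX
  by_cases hN : ∃ i₀ j₀ : Fin N, i₀ ≠ j₀
  · obtain ⟨i₀, j₀, h₀⟩ := hN
    exact FreeRegionMaximiser.exists_joined_maximiser hL h₀ hX
  · exact ⟨X, hX, JoinedIn.refl hX, fun Y _ d _ i j hij _ => (hN ⟨i, j, hij⟩).elim⟩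

end Summit.AtomisticToContinuum.BoseEinsteinCondensation.Theorems

end
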